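import Summits.CriticalPhenomena.PercolationContinuityZ3.Theorems.Transplant.SkelPhiCellsFineGeomT
import HarnessLib

/-!
(R-40) SUCCESSOR `…T` (hp-8 g42, 2026-08-23; ruling p3-g16 06:23:56Z, J18): the twin of `SkelPhiCellsSmallMS` over the PER-AXIS creep cap `PCells2T` (PlanarCells2TDefs:
`c i ≤ r (oth i)` instead of the uniform `c i ≤ cmax ≤ r j`); statements and proofs VERBATIM with `PCells2S ↦ PCells2T` (+ the renames of record of the T layer below it);
the only mathematical touch points are the places that read the cap, which only ever need the cross form `c (oth j) ≤ r j` (listed in the lane line of this file's landing).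
NO landed file is edited; `SkelPhiCellsSmallMS` stays valid (and is an instance of this file through `PCells2S.toT`). NON-VACUITY: inherited verbatim from `SkelPhiCellsSmallMS` (same witness line).

# N2 (frames-only node `SamePDropOfSkeletonFrm₁`, OPEN), WAVE-1 Geom re-base, part 4: THE SMALL ARRIVAL BOX over STAGGERED cells — `PCells2T.Mb b₀ v :=
# cenS v ± b₀`, the scheme twin `cellGeomSG₂bT G ψ P t Λ b₀` of `cellGeomSG₂T` with `M_a(x) := VWin ψ (Mb b₀ x) (rM a x)` (every other field
# definitionally that of `cellGeomSG₂T`), the eight scheme-geometry facts transferred field by field, and `geom_fineSkel_bT`; the `PCells2T` twin of hp-8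
# g33's `SkelPhiCellsSmallM` (RULING B.15; under (R-22) the (C) corridor's ARRIVAL box is this box with the slots `bα, bβ`)

builds on p205010 (kernel theorem, internal audit signed; external expert review pending) — nothing in this file uses p205010; nothing here is a
claim about the open node `SamePDropOfSkeletonFrm₁` (`SamePDropOfSkeletonNeg₁` is CLOSED in the tree and untouched by this file).
Lane `prim-bschramm`, seat `prim-hp-8` (gen 40); helper file (`--supports stmt-CriticalPhenomena-4575 --as helper`); design owner p3-g15 ((R-22): cube slots
`10u ≤ b ≤ 3r`; 2026-08-22T23:00:04Z: `Mb` about `cenS`, `Mb ⊆ M ⊆ QNS 2` so nothing else moves).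
* §1 `PCells2T.Mb`, `mem_Mb_iff`, `Mb_subset_M` (`b₀ ≤ 3r`), `cenS_mem_Mb`;
* §2 **`cellGeomSG₂bT`**, the `rfl` projections `cellGeomSG₂bT_M/_Q/_Cell/_Btw/_Efar/_Stub/_Zone/_Ewv/_col/_root/_a₀/_K/_anchor/_anchSet`, `M_bT_subset_M`, `cenS_mem_Mb'T`;
* §3 `runGeomSG₂bT`, `anchGeomSG₂bT`, `sepGeomSG₂bT`, `sepGeom₂SG₂bT`, `exitGeomSG₂bT`, `stepsGeomSG₂bT`, `levelGeomSG₂bT`, `qSepGeomSG₂bT`;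
* §4 **`geom_fineSkel_bT`**.
[cite: KozmaNitzan2024, §4 pp. 25–31 (Q_v, M_v, E_{v,x}; Lemma 11's landing rectangle)] [cite: MartineauTassion2017, §4.3]
-/

noncomputable section

open scoped Classical

namespace Summit.CriticalPhenomena.PercolationContinuityZ3.Theorems

namespace Transplant

open Literature.Probability.Percolation Literature.Probability.LatticeModels

/-! ## §1 The small planar box about the staggered centre -/

namespace PCells2T

variable (P : PCells2T)

/-- **The small arrival box** `cenS v ± b₀` (half-widths `b₀ i` fine cells) about the STAGGERED centre. [cite: KozmaNitzan2024, §4 p. 26 (M_v), Lemma 11 (p. 22)] -/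
def Mb (b₀ : Fin 2 → ℕ) (v : Site 2) : Finset (Site 2) :=
  Finset.Icc (PCells2T.cenS P v - fun i => ((b₀ i : ℕ) : ℤ)) (PCells2T.cenS P v + fun i => ((b₀ i : ℕ) : ℤ))

/-- Membership in the small box about the staggered centre. [folklore] -/
theorem mem_Mb_iff {b₀ : Fin 2 → ℕ} {v t : Site 2} :
    t ∈ PCells2T.Mb P b₀ v ↔ ∀ i, PCells2T.cenS P v i - b₀ i ≤ t i ∧ t i ≤ PCells2T.cenS P v i + b₀ i := by
  simp only [Mb, Finset.mem_Icc, Pi.le_def, Pi.sub_apply, Pi.add_apply]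
  exact ⟨fun h i => ⟨h.1 i, h.2 i⟩, fun h => ⟨fun i => (h i).1, fun i => (h i).2⟩⟩

/-- The small box lies in `M_v` when `b₀ ≤ 3r`. [folklore] -/
theorem Mb_subset_M {b₀ : Fin 2 → ℕ} (hb : ∀ i, b₀ i ≤ 3 * P.r i) (v : Site 2) : PCells2T.Mb P b₀ v ⊆ PCells2T.M P v := by
  intro t ht
  rw [mem_Mb_iff] at ht
  rw [M, mem_aboxS_iff]
  intro i; have h1 := ht i; have h2 := hb i; push_cast at h1 ⊢; constructor <;> omega

/-- The staggered centre lies in the small box. [folklore] -/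
theorem cenS_mem_Mb (b₀ : Fin 2 → ℕ) (v : Site 2) : PCells2T.cenS P v ∈ PCells2T.Mb P b₀ v := by
  rw [mem_Mb_iff]; intro i; constructor <;> omega

-- `Mb` is made irreducible so that the unifier never compares the twin scheme's arrival box with the old one field by field (all facts about it
-- go through `mem_Mb_iff` / `Mb_subset_M` / `cenS_mem_Mb`).
attribute [irreducible] PCells2T.Mb

end PCells2T

/-! ## §2 The scheme twin -/

namespace Skelφ

open Literature.Probability.Percolation Literature.Probability.LatticeModels SimpleGraph KNCells
open Literature.Probability.Percolation.KozmaNitzan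
open BoxProdZ2 (ConcRadiiG)
open TwoAxis.Para (detD rep₂)

variable {V : Type} [DecidableEq V] (G : SimpleGraph V) [G.LocallyFinite] (ψ : V → Site 2)

/-- **The concentric cell geometry over staggered cells with SMALL arrival boxes**: `cellGeomSG₂T` with `M_a(v) := VWin ψ (cenS v ± b₀) (rM a v)`, every
other field the same. [cite: KozmaNitzan2024, §4 pp. 25–26 (Q_v, M_v, E_{v,x}), Lemma 11 (p. 22)] -/
def cellGeomSG₂bT (P : PCells2T) (w₀ : V) (Λ : ConcRadiiG) (b₀ : Fin 2 → ℕ) : CellGeom V ℕ :=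
  { cellGeomSG₂T G ψ P w₀ Λ with M := fun a v => VWin G ψ w₀ (PCells2T.Mb P b₀ v) (Λ.rM a v) }

variable {G ψ}
variable (P : PCells2T) (w₀ : V) (Λ : ConcRadiiG) (b₀ : Fin 2 → ℕ)

/-- The small arrival box of the twin. [folklore] -/
@[simp] theorem cellGeomSG₂bT_M (a : ℕ) (v : Site 2) : (cellGeomSG₂bT G ψ P w₀ Λ b₀).M a v = VWin G ψ w₀ (PCells2T.Mb P b₀ v) (Λ.rM a v) := rfl
/-- Unchanged field. [folklore] -/
@[simp] theorem cellGeomSG₂bT_Q : (cellGeomSG₂bT G ψ P w₀ Λ b₀).Q = (cellGeomSG₂T G ψ P w₀ Λ).Q := rfl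
/-- Unchanged field. [folklore] -/
@[simp] theorem cellGeomSG₂bT_Cell : (cellGeomSG₂bT G ψ P w₀ Λ b₀).Cell = (cellGeomSG₂T G ψ P w₀ Λ).Cell := rfl
/-- Unchanged field. [folklore] -/
@[simp] theorem cellGeomSG₂bT_Btw : (cellGeomSG₂bT G ψ P w₀ Λ b₀).Btw = (cellGeomSG₂T G ψ P w₀ Λ).Btw := rfl
/-- Unchanged field. [folklore] -/
@[simp] theorem cellGeomSG₂bT_Efar : (cellGeomSG₂bT G ψ P w₀ Λ b₀).Efar = (cellGeomSG₂T G ψ P w₀ Λ).Efar := rfl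
/-- Unchanged field. [folklore] -/
@[simp] theorem cellGeomSG₂bT_Stub : (cellGeomSG₂bT G ψ P w₀ Λ b₀).Stub = (cellGeomSG₂T G ψ P w₀ Λ).Stub := rfl
/-- Unchanged field. [folklore] -/
@[simp] theorem cellGeomSG₂bT_Zone : (cellGeomSG₂bT G ψ P w₀ Λ b₀).Zone = (cellGeomSG₂T G ψ P w₀ Λ).Zone := rfl
/-- Unchanged derived field `E_{w,v}`. [folklore] -/
@[simp] theorem cellGeomSG₂bT_Ewv : (cellGeomSG₂bT G ψ P w₀ Λ b₀).Ewv = (cellGeomSG₂T G ψ P w₀ Λ).Ewv := by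
  funext a v δ; simp only [CellGeom.Ewv, cellGeomSG₂bT_Btw, cellGeomSG₂bT_Q]
/-- Unchanged field. [folklore] -/
@[simp] theorem cellGeomSG₂bT_col : (cellGeomSG₂bT G ψ P w₀ Λ b₀).col = (cellGeomSG₂T G ψ P w₀ Λ).col := rfl
/-- Unchanged field. [folklore] -/
@[simp] theorem cellGeomSG₂bT_root : (cellGeomSG₂bT G ψ P w₀ Λ b₀).root = w₀ := rfl
/-- Unchanged field. [folklore] -/
@[simp] theorem cellGeomSG₂bT_a₀ : (cellGeomSG₂bT G ψ P w₀ Λ b₀).a₀ = 0 := rfl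
/-- Unchanged field. [folklore] -/
@[simp] theorem cellGeomSG₂bT_K : (cellGeomSG₂bT G ψ P w₀ Λ b₀).K = P.K := rfl
/-- Unchanged field. [folklore] -/
@[simp] theorem cellGeomSG₂bT_anchor : (cellGeomSG₂bT G ψ P w₀ Λ b₀).anchor = (cellGeomSG₂T G ψ P w₀ Λ).anchor := rfl
/-- Unchanged field. [folklore] -/
@[simp] theorem cellGeomSG₂bT_anchSet : (cellGeomSG₂bT G ψ P w₀ Λ b₀).anchSet = (cellGeomSG₂T G ψ P w₀ Λ).anchSet := rfl

/-- **The small arrival box lies in the old one** (`b₀ ≤ 3r`). [folklore] -/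
theorem M_bT_subset_M {b₀ : Fin 2 → ℕ} (hb : ∀ i, b₀ i ≤ 3 * P.r i) (a : ℕ) (v : Site 2) :
    (cellGeomSG₂bT G ψ P w₀ Λ b₀).M a v ⊆ (cellGeomSG₂T G ψ P w₀ Λ).M a v := VWin_mono (P.Mb_subset_M hb v) le_rfl

/-- The staggered centre lies in the small arrival box — the planar fact for the room lemmas. [folklore] -/
theorem cenS_mem_Mb'T (v : Site 2) : PCells2T.cenS P v ∈ PCells2T.Mb P b₀ v := P.cenS_mem_Mb b₀ v

/-! ## §3 The eight scheme-geometry facts transfer -/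

section Records

variable {Λ} (hΛ : WFS2 P.toPCells2 Λ) (hψ0 : ψ w₀ = 0)

/-- `RunGeom`. [folklore] -/
theorem runGeomSG₂bT : RunGeom G (cellGeomSG₂bT G ψ P w₀ Λ b₀) where
  adjQ _ _ _ hy := exists_adj_of_mem_VWin hy
  adjBtw _ _ _ _ hy := exists_adj_of_mem_VWin hy
  adjStub _ _ _ _ _ _ hy := exists_adj_of_mem_VStair hy

/-- `AnchGeom`. [folklore] -/
theorem anchGeomSG₂bT : AnchGeom (cellGeomSG₂bT G ψ P w₀ Λ b₀) where
  refl a _ := Finset.mem_insert_self a {a + 1}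
  const _ _ _ := rfl

include hΛ hψ0 in
/-- `SepGeom` (no field reads `M`; transferred along the `rfl` projections). [cite: KozmaNitzan2024, §4 pp. 26–29] -/
theorem sepGeomSG₂bT (hlip : Lip G ψ) (hws : WeakSteps G ψ) (hcol : ∀ a x, ∃ y ∈ VWin G ψ w₀ (PCells2T.Q P x) (Λ.rQ a x), ψ y = PCells2T.cenS P x) :
    SepGeom G (cellGeomSG₂bT G ψ P w₀ Λ b₀) := by
  have h := sepGeomSG₂T P w₀ hΛ hψ0 hlip hws hcol
  constructor <;>
    simp only [cellGeomSG₂bT_Q, cellGeomSG₂bT_Cell, cellGeomSG₂bT_Btw, cellGeomSG₂bT_Efar, cellGeomSG₂bT_Stub, cellGeomSG₂bT_Zone, cellGeomSG₂bT_Ewv,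
      cellGeomSG₂bT_col, cellGeomSG₂bT_root, cellGeomSG₂bT_a₀, cellGeomSG₂bT_K, cellGeomSG₂bT_anchSet]
  exacts [h.anch_refl, h.root_mem, h.Q_subset_Cell, h.Btw_subset_Cells, h.Stub_subset_Q_union_Btw, h.Stub_subset_Cell_union_Zone,
    h.Efar_subset_Btw_union_Q, h.Ewv_disjoint_Efar, h.Q_disjoint_Q, h.Q_disjoint_Btw, h.Btw_disjoint_Btw, h.Q_disjoint_Efar, h.Btw_disjoint_Efar,
    h.col_Q, h.col_Cell, h.col_Zone]

include hΛ hψ0 in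
/-- `SepGeom₂`. [cite: KozmaNitzan2024, §4 pp. 25–26] -/
theorem sepGeom₂SG₂bT (hlip : Lip G ψ) (hws : WeakSteps G ψ) (hcol : ∀ a x, ∃ y ∈ VWin G ψ w₀ (PCells2T.Q P x) (Λ.rQ a x), ψ y = PCells2T.cenS P x) :
    SepGeom₂ G (cellGeomSG₂bT G ψ P w₀ Λ b₀) := by
  have h := sepGeom₂SG₂T P w₀ hΛ hψ0 hlip hws hcol
  refine ⟨sepGeomSG₂bT P w₀ b₀ hΛ hψ0 hlip hws hcol, ?_, ?_⟩ <;>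
    simp only [cellGeomSG₂bT_Q, cellGeomSG₂bT_Cell, cellGeomSG₂bT_Btw, cellGeomSG₂bT_anchSet]
  exacts [h.Q_subset_Cell₂, h.Btw_subset_Cells₂]

include hΛ in
/-- `ExitGeom` (`M ⊆ Q` through the old box). [cite: KozmaNitzan2024, §4 pp. 26–27] -/
theorem exitGeomSG₂bT (hlip : Lip G ψ) (hb : ∀ i, b₀ i ≤ 3 * P.r i) : ExitGeom G (cellGeomSG₂bT G ψ P w₀ Λ b₀) := by
  have h := exitGeomSG₂T P w₀ hΛ hlip
  constructor <;>
    simp only [cellGeomSG₂bT_M, cellGeomSG₂bT_Q, cellGeomSG₂bT_Cell, cellGeomSG₂bT_Zone, cellGeomSG₂bT_Ewv]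
  · exact fun a v => (VWin_mono (P.Mb_subset_M hb v) le_rfl).trans (h.M_subset_Q a v)
  · exact h.Cell_disjoint_Q
  · exact h.Zone_disjoint_Q
  · exact h.locFin

include hΛ in
/-- `StepsGeom` (`M_{v+δ} ⊆ E^far` through the old box). [cite: KozmaNitzan2024, §4 pp. 26, 30] -/
theorem stepsGeomSG₂bT (hlip : Lip G ψ) (hws : WeakSteps G ψ) (hb : ∀ i, b₀ i ≤ 3 * P.r i) :
    StepsGeom (cellGeomSG₂bT G ψ P w₀ Λ b₀) (faceDataSGT G ψ P w₀ Λ) := by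
  have h := stepsGeomSG₂T P w₀ hΛ hlip hws
  constructor <;>
    simp only [cellGeomSG₂bT_M, cellGeomSG₂bT_Q, cellGeomSG₂bT_Efar, cellGeomSG₂bT_Stub, cellGeomSG₂bT_K, cellGeomSG₂bT_anchSet]
  · exact h.Face_subset_Stub
  · exact h.Stub_subset_Hfull
  · exact h.Hfull_subset
  · exact fun a v δ => (VWin_mono (P.Mb_subset_M hb _) le_rfl).trans (h.M_tgt_subset_Efar a v δ)

include hΛ in
/-- `LevelGeom` (`M_far` through the old box). [cite: KozmaNitzan2024, §4 p. 31 (Step IV)] -/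
theorem levelGeomSG₂bT (hlip : Lip G ψ) (hb : ∀ i, b₀ i ≤ 3 * P.r i) :
    LevelGeom G (cellGeomSG₂bT G ψ P w₀ Λ b₀) (faceDataSGT G ψ P w₀ Λ) (levelDataST ψ P) := by
  have h := levelGeomSG₂T P w₀ hΛ hlip
  constructor <;>
    try simp only [cellGeomSG₂bT_M, cellGeomSG₂bT_Q, cellGeomSG₂bT_Cell, cellGeomSG₂bT_Btw, cellGeomSG₂bT_Efar, cellGeomSG₂bT_Stub,
      cellGeomSG₂bT_Zone, cellGeomSG₂bT_K, cellGeomSG₂bT_anchSet]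
  · exact h.adj_le
  · exact h.lev_Q
  · exact h.lev_Hfull
  · exact h.ℓQ_lt
  · exact h.mem_Stub
  · exact h.mem_Face
  · exact h.Face_far
  · exact fun a' v δ t ht => h.M_far a' v δ t (VWin_mono (P.Mb_subset_M hb _) le_rfl ht)
  · exact h.Btw_sep_Efar
  · exact h.Cell_sep_Efar
  · exact h.Zone_sep_Efar

/-- `QSepGeom`. [cite: KozmaNitzan2024, §4 p. 26 ((29))] -/
theorem qSepGeomSG₂bT (hlip : Lip G ψ) : QSepGeom G (cellGeomSG₂bT G ψ P w₀ Λ b₀) := by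
  have h := qSepGeomSG₂T P w₀ (Λ := Λ) hlip
  constructor <;> simp only [cellGeomSG₂bT_Q, cellGeomSG₂bT_Cell, cellGeomSG₂bT_Zone]
  · exact h.Cell_sep_Q
  · exact h.Zone_sep_Q

end Records

/-! ## §4 The scheme geometry of the fine cells with small arrival boxes, staggered cells -/

/-- **THE SCHEME GEOMETRY OF THE FINE CELLS OVER STAGGERED CELLS, SMALL ARRIVAL BOXES** (`geom_fineSkelT` at the twin; `b₀ ≤ 3r`).
[cite: KozmaNitzan2024, §4 pp. 25–31] -/
theorem geom_fineSkel_bT {φ : V → Site 2} (hlip : Lip G φ) (hstep : Steps G φ) (t : V) {A n h vα vβ c₀ c₁ : ℤ} (hc₀ : 0 < c₀) (hc₁ : 0 < c₁)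
    (hD : 0 < detD A n h vα vβ) (hL0 : c₀ * (|A| * (|vβ| + |vα|)) + 2 ≤ detD A n h vα vβ)
    (hL1 : c₁ * (|A| * (|n| + |h|)) + 2 ≤ detD A n h vα vβ) (P : PCells2T) {Λ : ConcRadiiG} (hΛ : WFS2 P.toPCells2 Λ)
    (hcolQ : ∀ a x, (rep₂ A n h vα vβ c₀ c₁ (PCells2T.cenS P x) 0).natAbs + (rep₂ A n h vα vβ c₀ c₁ (PCells2T.cenS P x) 1).natAbs + 1 ≤ Λ.rQ a x)
    {b₀ : Fin 2 → ℕ} (hb : ∀ i, b₀ i ≤ 3 * P.r i) :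
    let ψ := fineSkel φ t A n h vα vβ c₀ c₁ (detD A n h vα vβ / 2) (detD A n h vα vβ / 2) (detD A n h vα vβ)
    Lip G ψ ∧ RunGeom G (cellGeomSG₂bT G ψ P t Λ b₀) ∧ AnchGeom (cellGeomSG₂bT G ψ P t Λ b₀) ∧ SepGeom₂ G (cellGeomSG₂bT G ψ P t Λ b₀) ∧
      ExitGeom G (cellGeomSG₂bT G ψ P t Λ b₀) ∧ StepsGeom (cellGeomSG₂bT G ψ P t Λ b₀) (faceDataSGT G ψ P t Λ) ∧
      LevelGeom G (cellGeomSG₂bT G ψ P t Λ b₀) (faceDataSGT G ψ P t Λ) (levelDataST ψ P) ∧ QSepGeom G (cellGeomSG₂bT G ψ P t Λ b₀) := by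
  intro ψ
  obtain ⟨hlipψ, -, -, hsep, -, hsteps, -, -⟩ := geom_fineSkelT hlip hstep t hc₀ hc₁ hD hL0 hL1 P hΛ hcolQ
  have hws : WeakSteps G ψ := weakSteps_fineSkel hstep t hD hc₀.le hc₁.le
  -- `ψ t = 0` and the column vertices, as in `geom_fineSkelT`
  have hψ0 : ψ t = 0 := by
    have hD2 : 0 ≤ detD A n h vα vβ / 2 := Int.ediv_nonneg hD.le (by norm_num)
    have hD2' : detD A n h vα vβ / 2 < detD A n h vα vβ := by omega
    have h0 : TwoAxis.Para.coarse c₀ (detD A n h vα vβ / 2) (detD A n h vα vβ) 0 = 0 := by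
      unfold TwoAxis.Para.coarse; rw [mul_zero, zero_add]; exact Int.ediv_eq_zero_of_lt hD2 hD2'
    have h1 : TwoAxis.Para.coarse c₁ (detD A n h vα vβ / 2) (detD A n h vα vβ) 0 = 0 := by
      unfold TwoAxis.Para.coarse; rw [mul_zero, zero_add]; exact Int.ediv_eq_zero_of_lt hD2 hD2'
    have hrel : relφ φ t t = 0 := by funext i; simp [relφ]
    funext i
    fin_cases i
    · show ψ t 0 = 0
      simp only [ψ, fineSkel_apply_zero, hrel]; unfold TwoAxis.Para.lam0; simp [h0]
    · show ψ t 1 = 0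
      simp only [ψ, fineSkel_apply_one, hrel]; unfold TwoAxis.Para.lam1 TwoAxis.Para.bp; simp [h1]
  have hcol : ∀ a x, ∃ y ∈ VWin G ψ t (PCells2T.Q P x) (Λ.rQ a x), ψ y = PCells2T.cenS P x := fun a x =>
    hcol_fineSkelT hlip hstep t hc₀ hc₁ hD hL0 hL1 P x (hcolQ a x)
  exact ⟨hlipψ, runGeomSG₂bT P t b₀, anchGeomSG₂bT P t b₀, sepGeom₂SG₂bT P t b₀ hΛ hψ0 hlipψ hws hcol, exitGeomSG₂bT P t b₀ hΛ hlipψ hb,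
    stepsGeomSG₂bT P t b₀ hΛ hlipψ hws hb, levelGeomSG₂bT P t b₀ hΛ hlipψ hb, qSepGeomSG₂bT P t b₀ hlipψ⟩

end Skelφ

end Transplant

end Summit.CriticalPhenomena.PercolationContinuityZ3.Theorems

end
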